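import Mathlib
import HarnessLib
import HarnessLib.Audit
import Summits.NavierStokesRegularity.Statement
import Summits.NavierStokesRegularity.NavierStokesRegularity.Theses.RootDecompLitSlice
import Literature.Analysis.FluidPDE.HomogeneousEuler
import Literature.Analysis.FluidPDE.HomogeneousEulerProofs
import Literature.Analysis.FluidPDE.HomogeneousEulerAxisymmetricWindow
import Literature.Analysis.FluidPDE.AxisymmetricEuler
import Literature.Analysis.FluidPDE.VectorCalculus
import HarnessLib.Audit.Status.Attr

/-!
Route: RootDecompStaticSkirt

# Route RootDecompStaticSkirt — N16's supercritical terminal scar U cut by the relative local jolt —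
no STATIC supercritical skirt (attacked via terminal-profile tangents onto Shvydkoy's Euler cones),
no JOLTING skirt (residual)

ROOT DECOMPOSITION CELL decomp-ns (D-0178), node N25 «THE STATIC SKIRT» (lens-6 g13; critic CLEARED
2026-08-30T11:47:25Z, decomp-ns-crit-1-g4, SCORE
solid: «strict residual cut on the U-line 31734 → LJ with a mechanism that bites a named class»).
CHILD ROUTE of N16 `RootDecompLitSlice` rev 2
(route-NavierStokesRegularity-RootDecompLitSlice) at its item U `NoSupercriticalTameScar`
(stmt-NavierStokesRegularity-29565, shared with N20
`RootDecompMorreyBudget`); an ALTERNATIVE decomposition of U beside N16's booked clock split Uᶜ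
31733 ∧ Uᵃ 31734 (both kept: `RS ⟹ Uᶜ` and `Uᵃ ⟹ LJ`
are recorded edges, lens K3/K4, writer Sketch `critTame31733_of_RS` / `LJ_of_abrupt31734`). THE CUT
(EXACT, kernel K1 `noSupercriticalTameScar_iff_static_jolting`,
on the tree decl: `N16_noSupercriticalTameScar_iff_static_jolting`; writer Sketch
`litSliceU_iff_cells`): U ⟺ RS ∧ LJ. U says the terminal scar
r⁻¹ ∫_(B_r(x₀)) |u(T)|² of a tame first blow-up stays bounded as r → 0; its failure is witnessed by
a SUPERCRITICAL SCAR SEQUENCE r_k → 0, and on the last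
parabolic windows (T − r_k², T) × B_(r_k)(x₀) one compares the local JOLT ∫|u(t) − u(T)|² with the
scar mass ∫|u(T)|² (multiplied through, no division):
RS `NoStaticSupercriticalSkirt` = u is STATIC (jolt = o(mass) uniformly) along no supercritical scar
sequence; LJ `NoJoltingSupercriticalSkirt` = u JOLTS
(jolt ≥ c·mass at some time of every window) along none; excluded middle + extraction
(`Filter.extraction_of_frequently_atTop`) make the cut exact. It
suffices to show X = (N16's cone remainder P1 ∧ P2 ∧ J1 ∧ T ∧ G ∧ D, BY NAME) ∧ RS ∧ LJ; `closes`
re-proves K1's glue RS → LJ → U inline (choice of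
ρ_n < 1/(n+1) with S(ρ_n) > n, squeeze, extraction) and feeds N16's born `closes`. RS is ATTACKED:
zoom the terminal PROFILE (not the flow) with the
canonical amplitude N_k² = r_k⁻³∫_(B_(r_k))|u(T)|²; supercriticality (N_k r_k = S(r_k)^(1/2) → ∞)
kills viscosity and staticity kills time, so the tangent
of a static skirt is a STATIONARY EULER flow on ℝ³∖0, l₀-log-periodic of degree −a with a ∈ [1, 3/2]
forced — exactly Shvydkoy's class, where the TREE
holds two Liouville theorems (a = 1:
`Literature.Analysis.FluidPDE.shvydkoy_homogeneousSteadyEuler_alpha_one_holds`; axisymmetric 1 < a <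
2:
`IsHomogeneousSteadyEuler.eq_zero_of_isAxisymmetric`) — RS ⟺ RSᶜ ∧ RSʷ (kernel K5), RSᶜ ⟸ CE ∧ SL
(K6), CE `ConicalStaticSkirtIsEulerCone` the
EXPECTED THEOREM (FIRST PROVER TARGET, aside), SL `LogPeriodicSkirtLiouville` the S-free ENGINE
(aside; = the regularity-side dual of the refutation
route ConeTipCollapse's cone item 19062: `SL → ¬InteractingLogPeriodicCone` PROVED, K7). LJ is the
DECLARED RESIDUAL (UNDECIDED, IDEA-NEEDED; where the
ConeTipCollapse skeleton, Tao-type cascades and NSI pulse trains live by mechanism; strictly WEAKER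
than the residual of record Uᵃ 31734). STATICITY IS FREE
in the whole critically-tame column (K2/K3: a clock ‖u(t) − u(T)‖₂² ≤ K√(T − t) spends ≤ K r_k on
the last window while the mass is r_k S(r_k)), so g12's
quiet/clocked cells are inside RS. PIECE TAGS (census HOME/census/COSTUME-CENSUS-v9.md sha256
ebc95e3cbce4add10c9cf3a056c7953d714b9245702ac989bc9e6428e270041f,
row C68 «THE STATIC SKIRT»: LJ MODEL-LOADED conical-jolting, RS MODEL-EMPTY; critic CLEARED
11:47:25Z bus L494): RS NEW SPECIAL PIECE — S-necessary, WEAKER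
than S (named separating class: the ConeTipCollapse skeleton is JOLTING, RS vacuous-by-mechanism
there while S fails), strictly STRONGER than booked 31733,
ATTACKED; LJ DECLARED RESIDUAL — S-necessary, strictly WEAKER than 31734, UNDECIDED; CE aside
EXPECTED THEOREM (not S-necessary); SL aside S-free ENGINE
(IDEA-NEEDED in general; strata PROVED); cone bundle = N16's open items by name. Nothing here is
EQUIV to S or to U alone. PROVENANCE: lens file
HOME/decomp-ns-lens-6/StaticSkirt.lean sha256
659b06af68ce87c14155e435f8f7afa648aba7d76174399ed99d30873d13d144 (705 lines, rc 0, 0 sorry; BC7 6/6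
CLEAN in
bc/StaticSkirtProbe{1,2}{,b}.lean), card NODE-g13.md cf1988bf…; critic probe StaticSkirt_g13.lean
(792 lines; planted Iff.rfl vs 31733/31734 correctly
REFUSED); writer Sketch skirt/Sketch.lean (lens body + items verbatim, `Iff.rfl` ×4, inline glue
`closes` via N16's `closes`; rc 0, 0 sorry).
Lean: Summit.NavierStokesRegularity.NavierStokesRegularity.Theses.RootDecompLitSlice.NoTypeIBlowup ∧
Summit.NavierStokesRegularity.NavierStokesRegularity.Theses.RootDecompLitSlice.NoEnergyAtom ∧
Summit.NavierStokesRegularity.NavierStokesRegularity.Theses.RootDecompLitSlice.AtomFreeBlowupIsTame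
∧
Summit.NavierStokesRegularity.NavierStokesRegularity.Theses.RootDecompLitSlice.NoLitInvisibleTransient
∧
Summit.NavierStokesRegularity.NavierStokesRegularity.Theses.RootDecompLitSlice.LitCriticalSingularityIsTypeI
∧ Summit.NavierStokesRegularity.NavierStokesRegularity.Theses.RootDecompLitSlice.NoDarkBall ∧
NoStaticSupercriticalSkirt ∧ NoJoltingSupercriticalSkirt

## Assembly
X ⟹ S by N16's born `closes` BY NAME: the bundle supplies P1, P2, J1, T, G, D; U
`NoSupercriticalTameScar` is rebuilt inline from RS and LJ (lens K1 ⇐: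
an unbounded scar at x₀ gives a scar sequence by choice along ρ_n < 1/(n+1), S(ρ_n) > n; RS makes it
non-static; `Filter.extraction_of_frequently_atTop`
gives a jolting subsequence, still a scar sequence; LJ kills it) — writer glue.lean, kernel-checked
in skirt/Sketch.lean (`closes`, 0 sorry).

Rationale: WHY THIS LINE. Critic row 114 diagnosed the lineage: every vertex mechanism in play (JV, Seregin's
(6.6.1)/(6.6.2) programme, the tree's X_E `PowerGaugeEulerLiouville`
19832) needs a BOUNDED centred budget sup_r r⁻¹∫_(B_r)|u|², and U's content is precisely the regime
where that budget DIVERGES at the terminal slice. This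
node builds the mechanism FOR that regime and uses the divergence as the resource: along a
supercritical scar sequence the Leray–Hopf weak identity tested
at scale r_k and divided by N_k² r_k⁴ has viscous term ≲ ν/(N_k r_k) and time term ≲ ε_k^(1/2)/(N_k
r_k) (ε_k the relative jolt), both → 0 when the skirt
is static — the tangent is inviscid and steady. Along a geometric sequence r₀ l₀^(−k) the tangent is
l₀-log-periodic with a ∈ [1, 3/2] forced (a < 1 ⇒
bounded scar; a > 3/2 ⇒ u(T) ∉ L²_loc): Shvydkoy's homogeneous / discretely self-similar stationary
Euler class (arXiv:1510.03378 Prop. 2.1 a = 1, Prop. 5.1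
axisymmetric; arXiv:2305.05987 Thm 1.4/1.5 Beltrami / no-swirl on [1,2]), the cone class of the
draft refutation route ConeTipCollapse (item 19062,
window (1, 3/2)). Imported: blow-up bookkeeping of CKN/Seregin type for the weak identity,
Shvydkoy's Liouville theorems (two IN THE TREE), de Rham on the
simply connected ℝ³∖0 for the pressure. What no prior route does: N16/N20 and g12 recut U by the
GLOBAL clock; X_E 19832's members are H¹_loc Euler zoom
limits of the FLOW under a bounded budget (cones with a ≥ 1 have |∇W|² ∼ |y|^(−2a−2) ∉ L¹_loc and
are not members); lens-4's SPIKE ANATOMY is the CRITICAL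
analogue (bounded scar, Leray's equation). Nobody zooms the terminal PROFILE at a divergent scar.

RANKED CRUXES. #2 NoStaticSupercriticalSkirt (crux) — RS (NEW SPECIAL PIECE, ATTACKED): for every ν,
T > 0, every maximal classical solution u on [0,T) that is Leray–Hopf from a rapidly decaying datum
with ‖u(t) − u(T)‖₂ → 0 (N16's tame frame verbatim), every point x₀ and every supercritical scar
sequence r (r_k > 0, r_k → 0, r_k⁻¹∫_(B_(r_k)(x₀))|u(T)|² → ∞), u is NOT static along r (not: ∀ ε >
0, eventually in k, ∀ t ∈ (T − r_k², T), ∫_(B_(r_k))|u(t) − u(T)|² ≤ ε ∫_(B_(r_k))|u(T)|²). WEAKER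
than S (vacuity) and than U; strictly STRONGER than N16's Uᶜ 31733 (`RS ⟹ Uᶜ`, K3); RS ⟺ RSᶜ ∧ RSʷ
(K5), RSᶜ ⟸ CE ∧ SL (K6). [critic CLEARED 11:47:25Z; census v9 row C68] [deps:
ConicalStaticSkirtIsEulerCone, LogPeriodicSkirtLiouville] [difficulty: XL] (why it might fail: a
WILD static skirt (terminal tangent not C¹ log-periodic: rough tangents, continuous ratio drift)
escapes the cone road (RSʷ undecided), and a non-axisymmetric interacting log-periodic Euler cone
with a ∈ (1, 3/2) — ConeTipCollapse's bet — would make SL false.) [arXiv:1510.03378,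
arXiv:2305.05987, arXiv:2107.06509]
#3 NoJoltingSupercriticalSkirt (crux) — LJ (DECLARED RESIDUAL; UNDECIDED, IDEA-NEEDED — never a
prover target): in the same frame, for every x₀ and every supercritical scar sequence r, u does NOT
jolt along r (not: ∃ c > 0, ∀ k, ∃ t ∈ (T − r_k², T), c ∫_(B_(r_k))|u(T)|² < ∫_(B_(r_k))|u(t) −
u(T)|²). WEAKER than S (vacuity) and than U; strictly WEAKER than the residual of record Uᵃ 31734
(`Uᵃ ⟹ LJ`, K4; separating class: static skirts of abrupt solutions, now owned by RS); habitat of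
the ConeTipCollapse skeleton (a ∈ (1,3/2), Leray clock ⇒ relative jolt ≍ const log-periodically ⇒
JOLTING), Tao-type cascades and NSI pulse trains. [critic CLEARED 11:47:25Z; census v9 row C68:
MODEL-LOADED conical-jolting] [difficulty: open-problem] (why it might fail: a jolting supercritical
skirt is exactly what a collapsing interacting Euler cone with a Leray clock (ConeTipCollapse, a ∈
(1,3/2)) or an averaged/NSI-type pulse cascade would produce in genuine Navier–Stokes; no mechanism
of the cell bites it.) [arXiv:1402.0290, arXiv:1510.03378, arXiv:2107.06509]
#9 LitSliceConeRest (support) — N16's cone remainder BY NAME (no new content; bundled so that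
`closes` has three load-bearing binders): P1 `NoTypeIBlowup` ∧ P2 `NoEnergyAtom` ∧ J1
`AtomFreeBlowupIsTame` ∧ T `NoLitInvisibleTransient` ∧ G `LitCriticalSingularityIsTypeI` ∧ D
`NoDarkBall` — open items of route-NavierStokesRegularity-RootDecompLitSlice, staffed THERE; this
item closes when they do. [difficulty: XL] (why it might fail: it inherits N16's blocker P1 (Type-I
exclusion) and the lit-slice items T/G/D; nothing new is claimed here.) [arXiv:1402.0290]
#9 ConicalStaticSkirtIsEulerCone (support) — CE [aside] EXPECTED THEOREM, provable now (M–L), FIRST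
PROVER TARGET; not S-necessary (stated for every Leray–Hopf solution on [0,T]): the tangent field W
of the terminal profile along a STATIC geometric supercritical scar sequence r₀/l₀^k (annular-L²
convergence of the canonically normalised blow-ups assumed: `TangentAlong`), C¹ off the origin and
l₀-log-periodic of degree −a (a > 0), is — with some C¹ pressure P — an l₀-log-periodic STATIONARY
EULER CONE on ℝ³∖0 (the six clauses of ConeTipCollapse's item 19062 verbatim); if W is homogeneous
under all dilations the pair is a homogeneous stationary Euler pair (`IsHomogeneousSteadyEuler a W
P`) whose pressure inherits axisymmetry from W. Road: weak Leray–Hopf identity with tests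
θ((t−T)/r_k²) r_k⁻²… φ((x−x₀)/r_k), normalised by N_k² r_k⁴: time term ≲ ε_k^(1/2)/(N_k r_k)
(staticity enters through the quadratic term — critic's wording correction), viscous term ≲ ν/(N_k
r_k), N_k r_k = S(r_k)^(1/2) → ∞; de Rham on ℝ³∖0; constant of P fixed by l₀^(−2a) ≠ 1; pressure
symmetry by compactness of SO(2) → (ℝ,+). With SL it closes RSᶜ (K6), and with the tree's strata the
homogeneous a = 1 and axisymmetric 1 < a ≤ 3/2 sub-cells outright (`no_homogeneous_one_staticSkirt`,
`no_homogeneous_axisymmetric_staticSkirt`). [difficulty: L] (why it might fail: the only deep input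
— strong annular L² convergence of the rescaled terminal profiles — is a HYPOTHESIS here, so the
remaining risk is bookkeeping: measurability/integrability of u(T) ⊗ u(T) against the rescaled tests
and the passage lintegral → Bochner on annuli.) [arXiv:1510.03378, arXiv:1402.0290]
#9 LogPeriodicSkirtLiouville (support) — SL [aside] ENGINE, S-free (IDEA-NEEDED in general; strata
PROVED): no nonzero C¹ stationary Euler cone on ℝ³∖0 that is l₀-log-periodic of degree −a with a ∈
[1, 3/2], l₀ > 1 (velocity and pressure C¹ off 0, W(l₀x) = l₀^(−a) W(x), P(l₀x) = l₀^(−2a) P(x), div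
W = 0, (W·∇)W + ∇P = 0 ⇒ W ≡ 0 off 0). = ¬(cone clauses of ConeTipCollapse's 19062) on the closed
window without the equivariance/interaction riders (`SL → ¬InteractingLogPeriodicCone` PROVED, K7:
either side's progress settles the other's item); SL ⟹ SLʰ (Shvydkoy's conjecture on [1, 3/2]);
strata: homogeneous a = 1 PROVED in the tree (`shvydkoy_homogeneousSteadyEuler_alpha_one_holds`,
arXiv:1510.03378 Prop. 2.1), homogeneous axisymmetric 1 < a < 2 PROVED in the tree (Prop. 5.1),
Beltrami / axisymmetric-no-swirl on [1,2] in print (arXiv:2305.05987 Thm 1.4/1.5). [difficulty: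
open-problem] (why it might fail: discrete (one-ratio) self-similarity removes the Poincaré–Hopf /
spherical-Bernoulli forcing of the homogeneous proofs; an interacting O-equivariant cone with a ∈
(1, 3/2) is exactly what the refutation route ConeTipCollapse bets on.) [arXiv:1510.03378,
arXiv:2305.05987]

TWO-LAYER PLAN. Foreseen glued split of RS (tenure, after CE lands; lens booking B2): RS ⟸ RSᶜ
`NoConicalStaticSkirt` ∧ RSʷ `NoWildStaticSkirt` (kernel K5
`noStatic_iff_conical_wild`, exact), RSᶜ closed by CE ∧ SL (K6), RSʷ the second declared residual
(wild static skirts; UNDECIDED-with-test, instrument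
T-jolt requested from the census seat). Second prover target after CE: SL strata beyond axisymmetry
(Beltrami class from arXiv:2305.05987 Thm 1.4 is
typable now).

KILL CRITERIA. A jolting supercritical skirt constructed for genuine Navier–Stokes (e.g. a certified
ConeTipCollapse collapse with a ∈ (1,3/2)) refutes LJ and closes
the route `refuted:NoJoltingSupercriticalSkirt` — and with it U 29565, N16 and N20 (the cut is
exact). A non-axisymmetric interacting log-periodic Euler
cone on the window (19062 PROVED) kills the engine SL, sending RSᶜ back to IDEA-NEEDED (RS itself
survives as a statement). A refutation of CE as typed
(failure of the weak-identity bookkeeping under the annular-convergence hypothesis) would be a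
misstatement repair, not a death. If P1 is refuted the
whole lit-slice lineage dies (inherited).

NOT DECOMPOSED YET. RSᶜ / RSʷ (lens decls `NoConicalStaticSkirt`, `NoWildStaticSkirt`) are NOT filed
at birth (second layer reserved for the B2 split); SLʰ
`HomogeneousSkirtLiouville` and the proved strata are not items (by-name theorems / lens lemmas);
the instrument T-jolt (scar exponent, relative jolt,
amplitude ratio along r_k = 2^(−k) at the vorticity maximum of the stored K14/K20 runs) is a census
request, not an item.

CHEAPEST FALSIFIER. `exact?` / `lean search` for a tree theorem deciding SL on the open window
(should FAIL: only the a = 1 and axisymmetric strata are in the tree) — if it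
succeeds the engine is a citation and RSᶜ is theorem-grade; conversely, the ConeTipCollapse seat's
first certified interacting cone with a ∈ (1, 3/2)
kills SL at once. Cheapest model check: the census T-jolt readout
(HOME/census/gen-v9/TJOLT-READOUT.md sha256 6c3ed23b…) on Hou's stored terminal slices —
ε_k ↛ 0 places the scenario in LJ, ε_k → 0 with convergent amplitude ratio in RSᶜ (axisymmetric
stratum already a theorem).

NUMBERS. Items 6 (2 cruxes, 1 by-name support bundle, 2 asides, 1 assembly); `closes` load-bearing
binders 3; lens kernel 705 lines, 0 sorry, BC7 6/6 CLEAN (two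
runs, union of batteries all passed); writer Sketch rc 0, 0 sorry; statement lengths RS 815 / LJ 802
/ CE 1867 / SL 668 chars; window a ∈ [1, 3/2]
forced; tree strata a = 1 and axisymmetric 1 < a < 2 PROVED.

DEFINITION REQUESTS. None: `ScarSeq`, `StaticAlong`, `JoltingAlong`, `TangentAlong`,
`IsLogPeriodicEulerCone`, `HasConicalStaticSkirt` are fully unfolded in the item bodies
(lens §3 currency); `IsHomogeneousSteadyEuler`, `IsAxisymmetric`, `IsAxisymmetricScalar`,
`VectorCalculus.divergence`, `convect` are tree declarations.

Novelty: Searches RUN (lens-6 g13, 2026-08-30, both corpora, labelled; writer re-checked the tree with rg for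
`StaticAlong|JoltingAlong|ScarSeq|log-periodic` in
Theses/: only ConeTipCollapse's cone item and X_E's Shvydkoy tail): `lit vsearch` «rescale the
terminal velocity profile u(T) … stationary Euler … Shvydkoy
Liouville excludes the singularity» → textbooks only (frisch1995 p.63, majda2002 p.75, seregin2014
p.130, lemarie-rieusset2016 p.791; none on point)
[corpus: null]; `lit galaxy search "homogeneous solutions to the 3D Euler|discretely
self-similar|log-periodic" --star all` → 29 rows, all off-topic
[galaxy: null]; `lit galaxy search --star pdf "homogeneous solutions of stationary Euler|stationary
Euler cone|blow-up profile at the singular time"` → 0 hits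
[galaxy: null]. Nearest prior art FOUND: Shvydkoy 2018 [corpus:paper-arxiv-1510.03378 p.3 L22
(motivations: Euler self-similar tails, Onsager-critical
fields, Landau solutions), p.5 Prop 2.1, p.11 Prop 5.1]; Abe 2024 [corpus:paper-arxiv-2305.05987
p.1–5, Thm 1.4/1.5]; in the tree: X_E
`EulerZoomLiouville.PowerGaugeEulerLiouville` 19832 + its Shvydkoy-tail stratum (same ENGINE,
different VEHICLE: H¹_loc Euler zoom limits of the flow),
ConeTipCollapse 19062 (by-name dual), lens-4 SPIKE ANATOMY (critical analogue), g12 QUIET LANDING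
(global clock recut; JV under a bounded budget). In the
cell (bus L376–L509): no node zooms the terminal profile or types a static/jolting cut of a scar.
Delta in one sentence: the supercritical term  [refs: paper-arxiv-1510.03378, paper-arxiv-2305.05987]

Barriers (technique_class: terminal-profile zoom, stationary Euler cone Liouville): - technique_class: terminal-profile (not flow) zoom at a divergent scar with the canonical
amplitude; stationary Euler cone Liouville (Shvydkoy class) as engine; no a-priori estimate, no rate
hypothesis, no symmetry of u assumed.
- Literature.Barriers.NavierStokesRegularity.LeraySelfSimilarBlowupExclusion: not engaged — Leray /
DSS / Type-I profiles have bounded terminal scar (|u(T)| ≲ |x|⁻¹), so no scar sequence exists and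
RS, LJ are vacuous-by-mechanism there; U's content is empty in that class.
- Literature.Barriers.NavierStokesRegularity.TaoAveragedBlowup: outside for the special side — CE
uses the exact weak Navier–Stokes EQUATION (averaged/NSI solutions are not weak solutions of it) and
SL uses the exact Euler algebra on S² (Bernoulli function, Poincaré–Hopf); an averaged bilinear form
has no Bernoulli function — honest bet, not a theorem; averaged cascades jolt and live in LJ, which
is declared.
- Literature.Barriers.NavierStokesRegularity.NSITypeIIBlowup: outside — NSI pulse trains transfer
energy at every scale ⇒ JOLTING ⇒ LJ (declared); RS/CE are stated for solutions of the equation with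
equality and use it.
- Literature.Barriers.NavierStokesRegularity.AveragedTypeIBlowup: outside — it blocks Type-I
EXCLUSION by averaged-compatible arguments; this node neither excludes nor concludes a rate (P1 is
N16's inherited blocker, placed there); CE/SL use the exact equation and the exact Euler algebra on
S² — Tao's named evasion «fine structure of B».
- Literature.Barriers.Na

sub-problem: NavierStokesRegularity · status: draft · opened planner-decomp-ns-writer-1-g5-0 2026-08-30T12:51:42Z · rev 1 · ledger route-NavierStokesRegularity-RootDecompStaticSkirt
GENERATED by the gate from the ledger (D-0016/17). Provers cite these decls: `theorem foo : Summit.NavierStokesRegularity.NavierStokesRegularity.Theses.RootDecompStaticSkirt.<Decl> := …` in Summits/NavierStokesRegularity/NavierStokesRegularity/Theorems/<Name>.lean.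
-/

namespace Summit.NavierStokesRegularity.NavierStokesRegularity.Theses.RootDecompStaticSkirt

open scoped BigOperators Topology Manifold Classical MeasureTheory ProbabilityTheory Matrix InnerProductSpace ComplexConjugate ContinuousMap
open Filter Set Function TopologicalSpace MeasureTheory

attribute [summit_statement] _root_.NavierStokesRegularity

open Literature.NS

/-- item stmt-NavierStokesRegularity-33216 · crux · rank 2 · open · by planner
why it might fail: a WILD static skirt (terminal tangent not C¹ log-periodic: rough tangents, continuous ratio drift) escapes the cone road (RSʷ undecided), and a non-axisymmetric interacting log-periodic Euler cone with a ∈ (1, 3/2) — ConeTipCollapse's bet — would make SL false.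
sources: arXiv:1510.03378, arXiv:2305.05987, arXiv:2107.06509
[crux] RS (NEW SPECIAL PIECE, ATTACKED): for every ν, T > 0, every maximal classical solution u on
[0,T) that is Leray–Hopf from a rapidly decaying datum with ‖u(t) − u(T)‖₂ → 0 (N16's tame frame
verbatim), every point x₀ and every supercritical scar sequence r (r_k > 0, r_k → 0,
r_k⁻¹∫_(B_(r_k)(x₀))|u(T)|² → ∞), u is NOT static along r (not: ∀ ε > 0, eventually in k, ∀ t ∈ (T −
r_k², T), ∫_(B_(r_k))|u(t) − u(T)|² ≤ ε ∫_(B_(r_k))|u(T)|²). WEAKER than S (vacuity) and than U;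
strictly STRONGER than N16's Uᶜ 31733 (`RS ⟹ Uᶜ`, K3); RS ⟺ RSᶜ ∧ RSʷ (K5), RSᶜ ⟸ CE ∧ SL (K6).
[critic CLEARED 11:47:25Z; census v9 row C68] [deps: ConicalStaticSkirtIsEulerCone,
LogPeriodicSkirtLiouville] [difficulty: XL] -/
@[route_item "route-NavierStokesRegularity-RootDecompStaticSkirt", crux]
def NoStaticSupercriticalSkirt : Prop :=
  ∀ (ν T : ℝ), 0 < ν → 0 < T → ∀ (u : ℝ → EuclideanSpace ℝ (Fin 3) → EuclideanSpace ℝ (Fin 3)) (p : ℝ → EuclideanSpace ℝ (Fin 3) → ℝ), Literature.Analysis.FluidPDE.IsMaximalSmoothSolution ν 0 u p T → Literature.Analysis.FluidPDE.IsLerayHopfOn T ν 0 (u 0) u → Literature.Analysis.FluidPDE.HasRapidSpatialDecay (u 0) → Filter.Tendsto (fun t => MeasureTheory.eLpNorm (u t - u T) 2 MeasureTheory.volume) (nhdsWithin T (Set.Iio T)) (nhds 0) → ∀ (x₀ : EuclideanSpace ℝ (Fin 3)) (r : ℕ → ℝ), ((∀ k, 0 < r k) ∧ Filter.Tendsto r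 Filter.atTop (nhds 0) ∧ Filter.Tendsto (fun k => (r k)⁻¹ * ∫ x in Metric.ball x₀ (r k), ‖u T x‖ ^ 2) Filter.atTop Filter.atTop) → ¬ (∀ ε : ℝ, 0 < ε → ∃ k₀ : ℕ, ∀ k ≥ k₀, ∀ t ∈ Set.Ioo (T - r k ^ 2) T, ∫ x in Metric.ball x₀ (r k), ‖u t x - u T x‖ ^ 2 ≤ ε * ∫ x in Metric.ball x₀ (r k), ‖u T x‖ ^ 2)

/-- item stmt-NavierStokesRegularity-33217 · crux · rank 3 · SPLIT (gen 1) into NoTameConicalJoltingSkirt, NoRogueJoltingSkirt + glue NoJoltingSupercriticalSkirt_of_cells · direct attempts still welcome (low priority) · by planner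
why it might fail: a jolting supercritical skirt is exactly what a collapsing interacting Euler cone with a Leray clock (ConeTipCollapse, a ∈ (1,3/2)) or an averaged/NSI-type pulse cascade would produce in genuine Navier–Stokes; no mechanism of the cell bites it.
sources: arXiv:1402.0290, arXiv:1510.03378, arXiv:2107.06509
[crux] LJ (DECLARED RESIDUAL; UNDECIDED, IDEA-NEEDED — never a prover target): in the same frame,
for every x₀ and every supercritical scar sequence r, u does NOT jolt along r (not: ∃ c > 0, ∀ k, ∃
t ∈ (T − r_k², T), c ∫_(B_(r_k))|u(T)|² < ∫_(B_(r_k))|u(t) − u(T)|²). WEAKER than S (vacuity) and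
than U; strictly WEAKER than the residual of record Uᵃ 31734 (`Uᵃ ⟹ LJ`, K4; separating class:
static skirts of abrupt solutions, now owned by RS); habitat of the ConeTipCollapse skeleton (a ∈
(1,3/2), Leray clock ⇒ relative jolt ≍ const log-periodically ⇒ JOLTING), Tao-type cascades and NSI
pulse trains. [critic CLEARED 11:47:25Z; census v9 row C68: MODEL-LOADED conical-jolting]
[difficulty: open-problem] -/
@[route_item "route-NavierStokesRegularity-RootDecompStaticSkirt", crux]
def NoJoltingSupercriticalSkirt : Prop :=
  ∀ (ν T : ℝ), 0 < ν → 0 < T → ∀ (u : ℝ → EuclideanSpace ℝ (Fin 3) → EuclideanSpace ℝ (Fin 3)) (p : ℝ → EuclideanSpace ℝ (Fin 3) → ℝ), Literature.Analysis.FluidPDE.IsMaximalSmoothSolution ν 0 u p T → Literature.Analysis.FluidPDE.IsLerayHopfOn T ν 0 (u 0) u → Literature.Analysis.FluidPDE.HasRapidSpatialDecay (u 0) → Filter.Tendsto (fun t => MeasureTheory.eLpNorm (u t - u T) 2 MeasureTheory.volume) (nhdsWithin T (Set.Iio T)) (nhds 0) → ∀ (x₀ : EuclideanSpace ℝ (Fin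 3)) (r : ℕ → ℝ), ((∀ k, 0 < r k) ∧ Filter.Tendsto r Filter.atTop (nhds 0) ∧ Filter.Tendsto (fun k => (r k)⁻¹ * ∫ x in Metric.ball x₀ (r k), ‖u T x‖ ^ 2) Filter.atTop Filter.atTop) → ¬ (∃ c : ℝ, 0 < c ∧ ∀ k, ∃ t ∈ Set.Ioo (T - r k ^ 2) T, c * (∫ x in Metric.ball x₀ (r k), ‖u T x‖ ^ 2) < ∫ x in Metric.ball x₀ (r k), ‖u t x - u T x‖ ^ 2)

-- parent: NoJoltingSupercriticalSkirt · child (gen 1)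
/--     item stmt-NavierStokesRegularity-33319 · crux · rank 301 · open
    parent: NoJoltingSupercriticalSkirt · by planner
    why it might fail: its kill imports X_E's whole open core ρ ∈ (0,1/2] (a bounded ancient suitable Euler-gauge Liouville statement with no proof in print) and GX; a tame-conical jolting skirt realised by a genuine NS Type-II cascade (Tao-type, made exact) refutes it directly.
    sources: Seregin2026 Thm 3.1/(1.7) (arXiv:2507.08733), arXiv:2210.03215 (Seregin 2023 Prop 1.2), CKN1982 §2, arXiv:1402.0290
LJᶜ (ATTACKED special cell of LJ; lens-6 g14 «THE EULER GAUGE», CRITIC-LEDGER row 142 CLEARED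
modest-plus 12:57:29Z; census v11 C76/H84): in the tame frame of U, no JOLTING supercritical skirt
is TAME-CONICAL (tempered with a conical upper envelope ∫_{B_r}|u(T)|² ≤ C r^{3−2a} and temperate
jolt on the last parabolic windows, floored with a conical lower envelope along the scar sequence
and non-evacuating on the last advective window, one exponent a ∈ (1, 3/2]). KILLED modulo GX by the
S-free engine X_E = EulerZoomLiouville.PowerGaugeEulerLiouville (stmt-19832, open core ρ ∈ (0,1/2];
strata proved in tree) through the PROVED zoom Z SereginZoomReduction 19834 (lens K4
`noTameConicalJoltingSkirt_of_engine`, K1 A-gauge and K2 cubic floor PROVED from skirt geometry).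
WEAKER than S (vacuity) and than LJ; the census caricature population (K26 Type-II runs: conical a ∈
(1,3/2), temperate ε_k ∈ [0.65,1.55], non-evacuating) sits HERE. -/
@[route_item "route-NavierStokesRegularity-RootDecompStaticSkirt"]
def NoTameConicalJoltingSkirt : Prop :=
  ∀ (ν T : ℝ), 0 < ν → 0 < T → ∀ (u : ℝ → EuclideanSpace ℝ (Fin 3) → EuclideanSpace ℝ (Fin 3)) (p : ℝ → EuclideanSpace ℝ (Fin 3) → ℝ), Literature.Analysis.FluidPDE.IsMaximalSmoothSolution ν 0 u p T → Literature.Analysis.FluidPDE.IsLerayHopfOn T ν 0 (u 0) u → Literature.Analysis.FluidPDE.HasRapidSpatialDecay (u 0) → Filter.Tendsto (fun t => MeasureTheory.eLpNorm (u t - u T) 2 MeasureTheory.volume) (nhdsWithin T (Set.Iio T)) (nhds 0) → ∀ (x₀ : EuclideanSpace ℝ (Fin 3)) (r : ℕ → ℝ), ((∀ k, 0 < r k) ∧ Filter.Tendsto r Filter.atTop (nhds 0) ∧ Filter.Tendsto (fun k => (r k)⁻¹ * ∫ x in Metric.ball x₀ (r k), ‖u T x‖ ^ 2) Filter.atTop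 Filter.atTop) → (∃ c : ℝ, 0 < c ∧ ∀ k, ∃ t ∈ Set.Ioo (T - r k ^ 2) T, c * (∫ x in Metric.ball x₀ (r k), ‖u T x‖ ^ 2) < ∫ x in Metric.ball x₀ (r k), ‖u t x - u T x‖ ^ 2) → ¬ (∃ a r₀ C J c η : ℝ, 1 < a ∧ a ≤ 3 / 2 ∧ 0 < r₀ ∧ 0 ≤ C ∧ 0 ≤ J ∧ 0 < c ∧ 0 < η ∧ (∀ ρ ∈ Set.Ioc 0 r₀, (∫⁻ x in Metric.ball x₀ ρ, ‖u T x‖ₑ ^ 2 ≤ ENNReal.ofReal (C * ρ ^ (3 - 2 * a))) ∧ ∀ s ∈ Set.Ioo (T - ρ ^ 2 / ν) T, ∫⁻ x in Metric.ball x₀ ρ, ‖u s x - u T x‖ₑ ^ 2 ≤ ENNReal.ofReal J * ∫⁻ x in Metric.ball x₀ ρ, ‖u T x‖ₑ ^ 2) ∧ (∀ k : ℕ, ENNReal.ofReal (c * r k ^ (3 - 2 * a)) ≤ ∫⁻ x in Metric.ball x₀ (r k), ‖u T x‖ₑ ^ 2 ∧ ∀ s ∈ Set.Ioo (T - r k ^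 (1 + a) / ν) T, ENNReal.ofReal η * ∫⁻ x in Metric.ball x₀ (r k), ‖u T x‖ₑ ^ 2 ≤ ∫⁻ x in Metric.ball x₀ (r k), ‖u s x‖ₑ ^ 2))

-- parent: NoJoltingSupercriticalSkirt · child (gen 1)
/--     item stmt-NavierStokesRegularity-33320 · crux · rank 302 · open
    parent: NoJoltingSupercriticalSkirt · by planner
    why it might fail: a log-corrected or intermittently evacuating Type-II cascade (generic in dyadic/averaged models) would be a rogue jolting skirt; no NS mechanism forces a single power-law envelope on a jolting scar.
    sources: arXiv:1402.0290, Seregin2026 (1.5)-(1.6) (arXiv:2507.08733), HOME/census/gen-v9/TJOLT-READOUT.md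
LJʳ (DECLARED RESIDUAL of the g14 split; UNDECIDED; never a prover target): in the tame frame of U,
EVERY jolting supercritical skirt is tame-conical — i.e. no ROGUE jolting skirt: VIOLENT (relative
jolt unbounded at small scales), WILD (no one-exponent two-sided envelope: log-corrected / irregular
scars — idea-needed: log-gauge zoom, Seregin 2026 (1.5)–(1.6)) or EVACUATING (the advective window
empties the ball). WEAKER than S (vacuity) and than LJ (kernel `cells_of_noJolting`); LJ ⟺ LJᶜ ∧ LJʳ
exact by excluded middle (lens K3 `noJolting_iff_cells`); LJʳ ≡ LJ modulo the engine line (lens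
`noJolting_iff_rogue_of_engine`). Not model-empty beyond the caricatures (log-corrected Type-II
blow-up is generic in other models). -/
@[route_item "route-NavierStokesRegularity-RootDecompStaticSkirt"]
def NoRogueJoltingSkirt : Prop :=
  ∀ (ν T : ℝ), 0 < ν → 0 < T → ∀ (u : ℝ → EuclideanSpace ℝ (Fin 3) → EuclideanSpace ℝ (Fin 3)) (p : ℝ → EuclideanSpace ℝ (Fin 3) → ℝ), Literature.Analysis.FluidPDE.IsMaximalSmoothSolution ν 0 u p T → Literature.Analysis.FluidPDE.IsLerayHopfOn T ν 0 (u 0) u → Literature.Analysis.FluidPDE.HasRapidSpatialDecay (u 0) → Filter.Tendsto (fun t => MeasureTheory.eLpNorm (u t - u T) 2 MeasureTheory.volume) (nhdsWithin T (Set.Iio T)) (nhds 0) → ∀ (x₀ : EuclideanSpace ℝ (Fin 3)) (r : ℕ → ℝ), ((∀ k, 0 < r k) ∧ Filter.Tendsto r Filter.atTop (nhds 0) ∧ Filter.Tendsto (fun k => (r k)⁻¹ * ∫ x in Metric.ball x₀ (r k), ‖u T x‖ ^ 2) Filter.atTop Filter.atTop) → (∃ c : ℝ, 0 < c ∧ ∀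 k, ∃ t ∈ Set.Ioo (T - r k ^ 2) T, c * (∫ x in Metric.ball x₀ (r k), ‖u T x‖ ^ 2) < ∫ x in Metric.ball x₀ (r k), ‖u t x - u T x‖ ^ 2) → (∃ a r₀ C J c η : ℝ, 1 < a ∧ a ≤ 3 / 2 ∧ 0 < r₀ ∧ 0 ≤ C ∧ 0 ≤ J ∧ 0 < c ∧ 0 < η ∧ (∀ ρ ∈ Set.Ioc 0 r₀, (∫⁻ x in Metric.ball x₀ ρ, ‖u T x‖ₑ ^ 2 ≤ ENNReal.ofReal (C * ρ ^ (3 - 2 * a))) ∧ ∀ s ∈ Set.Ioo (T - ρ ^ 2 / ν) T, ∫⁻ x in Metric.ball x₀ ρ, ‖u s x - u T x‖ₑ ^ 2 ≤ ENNReal.ofReal J * ∫⁻ x in Metric.ball x₀ ρ, ‖u T x‖ₑ ^ 2) ∧ (∀ k : ℕ, ENNReal.ofReal (c * r k ^ (3 - 2 * a)) ≤ ∫⁻ x in Metric.ball x₀ (r k), ‖u T x‖ₑ ^ 2 ∧ ∀ s ∈ Set.Ioo (T - r k ^ (1 + a) / ν) T, ENNReal.ofReal η * ∫⁻ x in Metric.ball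 x₀ (r k), ‖u T x‖ₑ ^ 2 ≤ ∫⁻ x in Metric.ball x₀ (r k), ‖u s x‖ₑ ^ 2))

-- parent: NoJoltingSupercriticalSkirt · glue (gen 1)
/--     item stmt-NavierStokesRegularity-33321 · support · rank 303 · closed · proved by Summit.NavierStokesRegularity.NavierStokesRegularity.Theorems.rootDecompStaticSkirt_noJoltingSupercriticalSkirt_of_cells_proof (planner)
    parent: NoJoltingSupercriticalSkirt · GLUE: children ⟹ parent · by planner
LJc -> LJr -> LJ: excluded middle on "the jolting skirt is tame-conical" (lens-6 g14 EulerGauge.lean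
K3 noJolting_iff_cells EXACT; writer gauge/Sketch.lean NoJoltingSupercriticalSkirt_of_cells PROVED
against the tree decl, rc 0, 0 sorry) -/
@[route_item "route-NavierStokesRegularity-RootDecompStaticSkirt"]
def NoJoltingSupercriticalSkirt_of_cells : Prop :=
  NoTameConicalJoltingSkirt → NoRogueJoltingSkirt → NoJoltingSupercriticalSkirt

-- `NoJoltingSupercriticalSkirt_of_cells` holds: proved by `Summit.NavierStokesRegularity.NavierStokesRegularity.Theorems.rootDecompStaticSkirt_noJoltingSupercriticalSkirt_of_cells_proof` (its module imports this route file, so no `_holds` link can be stated here).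

/-- item stmt-NavierStokesRegularity-33218 · support · rank 9 · open · by planner
why it might fail: it inherits N16's blocker P1 (Type-I exclusion) and the lit-slice items T/G/D; nothing new is claimed here.
sources: arXiv:1402.0290
[support] N16's cone remainder BY NAME (no new content; bundled so that `closes` has three
load-bearing binders): P1 `NoTypeIBlowup` ∧ P2 `NoEnergyAtom` ∧ J1 `AtomFreeBlowupIsTame` ∧ T
`NoLitInvisibleTransient` ∧ G `LitCriticalSingularityIsTypeI` ∧ D `NoDarkBall` — open items of
route-NavierStokesRegularity-RootDecompLitSlice, staffed THERE; this item closes when they do.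
[difficulty: XL] -/
@[route_item "route-NavierStokesRegularity-RootDecompStaticSkirt", crux]
def LitSliceConeRest : Prop :=
  Summit.NavierStokesRegularity.NavierStokesRegularity.Theses.RootDecompLitSlice.NoTypeIBlowup ∧ Summit.NavierStokesRegularity.NavierStokesRegularity.Theses.RootDecompLitSlice.NoEnergyAtom ∧ Summit.NavierStokesRegularity.NavierStokesRegularity.Theses.RootDecompLitSlice.AtomFreeBlowupIsTame ∧ Summit.NavierStokesRegularity.NavierStokesRegularity.Theses.RootDecompLitSlice.NoLitInvisibleTransient ∧ Summit.NavierStokesRegularity.NavierStokesRegularity.Theses.RootDecompLitSlice.LitCriticalSingularityIsTypeI ∧ Summit.NavierStokesRegularity.NavierStokesRegularity.Theses.RootDecompLitSlice.NoDarkBall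

/-- item stmt-NavierStokesRegularity-33219 · aside · rank 9 · open · by planner
why it might fail: the only deep input — strong annular L² convergence of the rescaled terminal profiles — is a HYPOTHESIS here, so the remaining risk is bookkeeping: measurability/integrability of u(T) ⊗ u(T) against the rescaled tests and the passage lintegral → Bochner on annuli.
sources: arXiv:1510.03378, arXiv:1402.0290
[support] CE [aside] EXPECTED THEOREM, provable now (M–L), FIRST PROVER TARGET; not S-necessary
(stated for every Leray–Hopf solution on [0,T]): the tangent field W of the terminal profile along a
STATIC geometric supercritical scar sequence r₀/l₀^k (annular-L² convergence of the canonically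
normalised blow-ups assumed: `TangentAlong`), C¹ off the origin and l₀-log-periodic of degree −a (a
> 0), is — with some C¹ pressure P — an l₀-log-periodic STATIONARY EULER CONE on ℝ³∖0 (the six
clauses of ConeTipCollapse's item 19062 verbatim); if W is homogeneous under all dilations the pair
is a homogeneous stationary Euler pair (`IsHomogeneousSteadyEuler a W P`) whose pressure inherits
axisymmetry from W. Road: weak Leray–Hopf identity with tests θ((t−T)/r_k²) r_k⁻²… φ((x−x₀)/r_k),
normalised by N_k² r_k⁴: time term ≲ ε_k^(1/2)/(N_k r_k) (staticity enters through the quadratic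
term — critic's wording correction), viscous term ≲ ν/(N_k r_k), N_k r_k = S(r_k)^(1/2) → ∞; de Rham
on ℝ³∖0; constant of P fixed by l₀^(−2a) ≠ 1; pressure symmetry by compactness of SO(2) → (ℝ,+).
With SL it closes RSᶜ (K6), and with the tree's strata the homogeneous a = 1 and axisymmetric 1 < a
≤ 3/2 sub-cells outri -/
@[route_item "route-NavierStokesRegularity-RootDecompStaticSkirt"]
def ConicalStaticSkirtIsEulerCone : Prop :=
  ∀ (ν T : ℝ), 0 < ν → 0 < T → ∀ (u : ℝ → EuclideanSpace ℝ (Fin 3) → EuclideanSpace ℝ (Fin 3)), Literature.Analysis.FluidPDE.IsLerayHopfOn T ν 0 (u 0) u → ∀ (x₀ : EuclideanSpace ℝ (Fin 3)) (r₀ l₀ a : ℝ) (W : EuclideanSpace ℝ (Fin 3) → EuclideanSpace ℝ (Fin 3)), 0 < r₀ → 1 < l₀ → 0 < a → ((∀ k : ℕ, 0 < r₀ / l₀ ^ k) ∧ Filter.Tendsto (fun k : ℕ => r₀ / l₀ ^ k) Filter.atTop (nhds 0) ∧ Filter.Tendsto (fun k : ℕ => (r₀ / l₀ ^ k)⁻¹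 * ∫ x in Metric.ball x₀ (r₀ / l₀ ^ k), ‖u T x‖ ^ 2) Filter.atTop Filter.atTop) → (∀ ε : ℝ, 0 < ε → ∃ k₀ : ℕ, ∀ k ≥ k₀, ∀ t ∈ Set.Ioo (T - (r₀ / l₀ ^ k) ^ 2) T, ∫ x in Metric.ball x₀ (r₀ / l₀ ^ k), ‖u t x - u T x‖ ^ 2 ≤ ε * ∫ x in Metric.ball x₀ (r₀ / l₀ ^ k), ‖u T x‖ ^ 2) → (∀ ρ₁ ρ₂ : ℝ, 0 < ρ₁ → ρ₁ < ρ₂ → Filter.Tendsto (fun k : ℕ => ∫ y in Metric.ball (0 : EuclideanSpace ℝ (Fin 3)) ρ₂ \ Metric.closedBall 0 ρ₁, ‖(Real.sqrt (((r₀ / l₀ ^ k) ^ 3)⁻¹ * ∫ x in Metric.ball x₀ (r₀ / l₀ ^ k), ‖u T x‖ ^ 2))⁻¹ • u T (x₀ + (r₀ / l₀ ^ k) • y) - W y‖ ^ 2) Filter.atTop (nhds 0)) → ContDiffOn ℝ 1 W {y | y ≠ 0} → (∀ y, y ≠ 0 → W (l₀ • y) = (l₀ ^ (-a)) • W y) →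 (∃ P : EuclideanSpace ℝ (Fin 3) → ℝ, (ContDiffOn ℝ 1 W {x : EuclideanSpace ℝ (Fin 3) | x ≠ 0} ∧ ContDiffOn ℝ 1 P {x : EuclideanSpace ℝ (Fin 3) | x ≠ 0} ∧ (∀ x : EuclideanSpace ℝ (Fin 3), x ≠ 0 → W (l₀ • x) = (l₀ ^ (-a)) • W x) ∧ (∀ x : EuclideanSpace ℝ (Fin 3), x ≠ 0 → P (l₀ • x) = l₀ ^ (-(2 * a)) * P x) ∧ (∀ x : EuclideanSpace ℝ (Fin 3), x ≠ 0 → Literature.Analysis.FluidPDE.VectorCalculus.divergence W x = 0) ∧ (∀ x : EuclideanSpace ℝ (Fin 3), x ≠ 0 → Literature.Analysis.FluidPDE.convect W W x + gradient P x = 0))) ∧ ((∀ c : ℝ, 0 < c → ∀ y, y ≠ 0 → W (c • y) = (c ^ (-a)) • W y) → ∃ P : EuclideanSpace ℝ (Fin 3) → ℝ, Literature.Analysis.FluidPDE.IsHomogeneousSteadyEuler a W P ∧ (Literature.Analysis.FluidPDE.IsAxisymmetric W → Literature.Analysis.FluidPDE.IsAxisymmetricScalar P))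

/-- item stmt-NavierStokesRegularity-33220 · aside · rank 9 · open · by planner
why it might fail: discrete (one-ratio) self-similarity removes the Poincaré–Hopf / spherical-Bernoulli forcing of the homogeneous proofs; an interacting O-equivariant cone with a ∈ (1, 3/2) is exactly what the refutation route ConeTipCollapse bets on.
sources: arXiv:1510.03378, arXiv:2305.05987
[support] SL [aside] ENGINE, S-free (IDEA-NEEDED in general; strata PROVED): no nonzero C¹
stationary Euler cone on ℝ³∖0 that is l₀-log-periodic of degree −a with a ∈ [1, 3/2], l₀ > 1
(velocity and pressure C¹ off 0, W(l₀x) = l₀^(−a) W(x), P(l₀x) = l₀^(−2a) P(x), div W = 0, (W·∇)W +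
∇P = 0 ⇒ W ≡ 0 off 0). = ¬(cone clauses of ConeTipCollapse's 19062) on the closed window without the
equivariance/interaction riders (`SL → ¬InteractingLogPeriodicCone` PROVED, K7: either side's
progress settles the other's item); SL ⟹ SLʰ (Shvydkoy's conjecture on [1, 3/2]); strata:
homogeneous a = 1 PROVED in the tree (`shvydkoy_homogeneousSteadyEuler_alpha_one_holds`,
arXiv:1510.03378 Prop. 2.1), homogeneous axisymmetric 1 < a < 2 PROVED in the tree (Prop. 5.1),
Beltrami / axisymmetric-no-swirl on [1,2] in print (arXiv:2305.05987 Thm 1.4/1.5). [difficulty: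
open-problem] -/
@[route_item "route-NavierStokesRegularity-RootDecompStaticSkirt"]
def LogPeriodicSkirtLiouville : Prop :=
  ∀ (a l₀ : ℝ) (W : EuclideanSpace ℝ (Fin 3) → EuclideanSpace ℝ (Fin 3)) (P : EuclideanSpace ℝ (Fin 3) → ℝ), 1 ≤ a → a ≤ 3 / 2 → 1 < l₀ → (ContDiffOn ℝ 1 W {x : EuclideanSpace ℝ (Fin 3) | x ≠ 0} ∧ ContDiffOn ℝ 1 P {x : EuclideanSpace ℝ (Fin 3) | x ≠ 0} ∧ (∀ x : EuclideanSpace ℝ (Fin 3), x ≠ 0 → W (l₀ • x) = (l₀ ^ (-a)) • W x) ∧ (∀ x : EuclideanSpace ℝ (Fin 3), x ≠ 0 → P (l₀ • x) = l₀ ^ (-(2 * a)) * P x) ∧ (∀ x : EuclideanSpace ℝ (Fin 3), x ≠ 0 → Literature.Analysis.FluidPDE.VectorCalculus.divergence W x = 0) ∧ (∀ x : EuclideanSpace ℝ (Fin 3), x ≠ 0 → Literature.Analysis.FluidPDE.convect W W x + gradient P x = 0)) → ∀ y : EuclideanSpace ℝ (Fin 3), y ≠ 0 → W y = 0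

/-- item stmt-NavierStokesRegularity-33328 · support · rank 9 · open · by planner
[support] GX ConicalSkirtFluxGauge (lens-6 g14 THE EULER GAUGE; UNDECIDED, instrumentable; NOT a
coverage leg: a flux estimate at a located vertex): at a tame-conical jolting supercritical skirt
vertex x0 (exponent a) of a tame first blow-up, the normalised solution v = u(./nu)/nu is, with some
admissible pressure q and weak gradient G, a suitable weak solution in every small parabolic ball at
(nu T, x0), and its dissipation and pressure gauges hold AT THE SKIRT'S EXPONENT: r^(a-1) E(r) +
r^(2(a-1)) D(r) <= M for small r. Why it might fail: a tame blow-up whose terminal skirt is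
tame-conical but whose space-time dissipation or pressure in Q_r exceeds the cascade rate (by a
logarithm) breaks it, and no a-priori NS estimate ties E(r), D(r) to the terminal slice (the local
energy inequality loses r^(-2 rho)). Sources: Seregin 2026 Thm 3.1/(1.7) arXiv:2507.08733; Seregin
2023 Prop 1.2 arXiv:2210.03215; CKN 1982 sec. 2; Albritton-Barker 2019 Def 2.1 arXiv:1811.00502.
Census instrument T-gauge-skirt (HOME/census/gen-v11/TGAUGE-READOUT.md). With the engine line
EngineKillsConicalJolt and the S-free engine X_E (EulerZoomLiouville.PowerGaugeEulerLiouville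
stmt-19832) it kills LJc 33319. -/
@[route_item "route-NavierStokesRegularity-RootDecompStaticSkirt"]
def ConicalSkirtFluxGauge : Prop :=
  ∀ (ν T : ℝ), 0 < ν → 0 < T → ∀ (u : ℝ → EuclideanSpace ℝ (Fin 3) → EuclideanSpace ℝ (Fin 3)) (p : ℝ → EuclideanSpace ℝ (Fin 3) → ℝ), Literature.Analysis.FluidPDE.IsMaximalSmoothSolution ν 0 u p T → Literature.Analysis.FluidPDE.IsLerayHopfOn T ν 0 (u 0) u → Literature.Analysis.FluidPDE.HasRapidSpatialDecay (u 0) → Filter.Tendsto (fun t => MeasureTheory.eLpNorm (u t - u T) 2 MeasureTheory.volume) (nhdsWithin T (Set.Iio T)) (nhds 0) → ∀ (x₀ : EuclideanSpace ℝ (Fin 3)) (r : ℕ → ℝ) (a r₀ C J c η : ℝ), ((∀ k, 0 < r k) ∧ Filter.Tendsto r Filter.atTop (nhds 0) ∧ Filter.Tendsto (fun k => (r k)⁻¹ * ∫ x in Metric.ball x₀ (r k), ‖u T x‖ ^ 2) Filter.atTop Filter.atTop) → (∃ c : ℝ, 0 < c ∧ ∀ k, ∃ t ∈ Set.Ioo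 (T - r k ^ 2) T, c * (∫ x in Metric.ball x₀ (r k), ‖u T x‖ ^ 2) < ∫ x in Metric.ball x₀ (r k), ‖u t x - u T x‖ ^ 2) → 1 < a → a ≤ 3 / 2 → 0 < r₀ → 0 ≤ C → 0 ≤ J → 0 < c → 0 < η → (∀ ρ ∈ Set.Ioc 0 r₀, (∫⁻ x in Metric.ball x₀ ρ, ‖u T x‖ₑ ^ 2 ≤ ENNReal.ofReal (C * ρ ^ (3 - 2 * a))) ∧ ∀ s ∈ Set.Ioo (T - ρ ^ 2 / ν) T, ∫⁻ x in Metric.ball x₀ ρ, ‖u s x - u T x‖ₑ ^ 2 ≤ ENNReal.ofReal J * ∫⁻ x in Metric.ball x₀ ρ, ‖u T x‖ₑ ^ 2) → (∀ k : ℕ, ENNReal.ofReal (c * r k ^ (3 - 2 * a)) ≤ ∫⁻ x in Metric.ball x₀ (r k), ‖u T x‖ₑ ^ 2 ∧ ∀ s ∈ Set.Ioo (T - r k ^ (1 + a) / ν) T, ENNReal.ofReal η * ∫⁻ x in Metric.ball x₀ (r k), ‖u T x‖ₑ ^ 2 ≤ ∫⁻ x in Metric.ball x₀ (r k), ‖u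 s x‖ₑ ^ 2) → ∃ (q : ℝ → EuclideanSpace ℝ (Fin 3) → ℝ) (G : ℝ → EuclideanSpace ℝ (Fin 3) → EuclideanSpace ℝ (Fin 3) →L[ℝ] EuclideanSpace ℝ (Fin 3)) (r₁ : ℝ) (M : NNReal), 0 < r₁ ∧ (∀ r' ∈ Set.Ioc 0 r₁, Literature.Analysis.FluidPDE.IsSuitableWeakSolutionInBall r' (ν * T, x₀) (fun s y => ν⁻¹ • u (s / ν) y) q ∧ Literature.Analysis.FluidPDE.HasWeakSpatialGradientOn (Literature.Analysis.FluidPDE.parabolicCylinderOpens r' (ν * T, x₀)) (fun s y => ν⁻¹ • u (s / ν) y) G) ∧ (∀ r' ∈ Set.Ioc 0 r₁, ENNReal.ofReal (r' ^ (a - 1)) * Literature.Analysis.FluidPDE.cknE r' (ν * T, x₀) G + ENNReal.ofReal (r' ^ (2 * (a - 1))) * Literature.Analysis.FluidPDE.cknD r' (ν * T, x₀) q ≤ (M : ENNReal))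

/-- item stmt-NavierStokesRegularity-33329 · support · rank 9 · closed · proved by Summit.NavierStokesRegularity.NavierStokesRegularity.Theorems.RootDecompStaticSkirtEngineKill.rootDecompStaticSkirt_engineKillsConicalJolt_proof (planner) · by planner
[support] K4 ENGINE LINE (PROVED in the lens kernel: EulerGauge.lean
noTameConicalJoltingSkirt_of_engine, 0 sorry, sha256 69e4a3f8...; landable as a Theorems file
importing Theses.EulerZoomLiouville + Theorems.EulerZoomLiouvilleSereginZoomReduction): X_E -> GX ->
LJc, where the antecedent is EulerZoomLiouville.PowerGaugeEulerLiouville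
(stmt-NavierStokesRegularity-19832, the S-free Euler-gauge Liouville engine, open core rho in
(0,1/2]; strata proved in tree) written VERBATIM (lens powerGaugeEulerLiouville_iff_19832 :=
Iff.rfl; this route file does not import Theses.EulerZoomLiouville, hence inlined), GX =
ConicalSkirtFluxGauge, LJc = NoTameConicalJoltingSkirt 33319. Mechanism: K1 (A-gauge from
temperedness) and K2 (cubic floor from flooredness) PROVED from skirt geometry give Seregin's
hypotheses at the skirt's own gauge rho = a - 1; GX supplies suitability and the E- /D-gauges; the
PROVED zoom Z = EulerZoomLiouville.SereginZoomReduction (stmt-19834,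
Theorems.EulerZoomLiouvilleSereginZoomReduction.sereginZoomReduction_proof) rescales to a member of
X_E's class that is not a.e. zero. Sources: arXiv:2507.08733, arXiv:2210.03215. -/
@[route_item "route-NavierStokesRegularity-RootDecompStaticSkirt"]
def EngineKillsConicalJolt : Prop :=
  (∀ ρ : ℝ, 0 < ρ → ∀ (u : ℝ → EuclideanSpace ℝ (Fin 3) → EuclideanSpace ℝ (Fin 3)) (p : ℝ → EuclideanSpace ℝ (Fin 3) → ℝ) (H : ℝ → EuclideanSpace ℝ (Fin 3) → EuclideanSpace ℝ (Fin 3) →L[ℝ] EuclideanSpace ℝ (Fin 3)) (c : NNReal), Literature.Analysis.FluidPDE.IsSuitableWeakSolutionOn (Literature.Analysis.FluidPDE.slab (EuclideanSpace ℝ (Fin 3)) (Set.Iio 0) isOpen_Iio) 0 0 u p → Literature.Analysis.FluidPDE.HasWeakSpatialGradientOn (Literature.Analysis.FluidPDE.slab (EuclideanSpace ℝ (Fin 3)) (Set.Iio 0) isOpen_Iio) u H → (∀ a : ℝ, 0 < a → ENNReal.ofReal (a ^ (2 * ρ)) * Literature.Analysis.FluidPDE.cknA a (0 : ℝ × EuclideanSpace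 ℝ (Fin 3)) u + ENNReal.ofReal (a ^ ρ) * Literature.Analysis.FluidPDE.cknE a (0 : ℝ × EuclideanSpace ℝ (Fin 3)) H + ENNReal.ofReal (a ^ (2 * ρ)) * Literature.Analysis.FluidPDE.cknD a (0 : ℝ × EuclideanSpace ℝ (Fin 3)) p ≤ (c : ENNReal)) → Function.uncurry u =ᵐ[MeasureTheory.volume.restrict (Set.Iio (0 : ℝ) ×ˢ (Set.univ : Set (EuclideanSpace ℝ (Fin 3))))] 0) → ConicalSkirtFluxGauge → NoTameConicalJoltingSkirt

-- `EngineKillsConicalJolt` holds: proved by `Summit.NavierStokesRegularity.NavierStokesRegularity.Theorems.RootDecompStaticSkirtEngineKill.rootDecompStaticSkirt_engineKillsConicalJolt_proof` (its module imports this route file, so no `_holds` link can be stated here).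

/-- item stmt-NavierStokesRegularity-33221 · assembly · rank 1 · open · by planner
[assembly] the cone remainder, RS and LJ imply Clay (A). -/
@[route_item "route-NavierStokesRegularity-RootDecompStaticSkirt"]
def Assembly : Prop :=
  LitSliceConeRest → NoStaticSupercriticalSkirt → NoJoltingSupercriticalSkirt → NavierStokesRegularity

/-! D-0027 §2.1 — DECIDING THEOREM (planner-authored via `route open/edit --closes-file`; by planner-decomp-ns-writer-1-g5-0 2026-08-30T12:51:42Z):
its hypotheses are this route's items and its conclusion the sub-problem Statement (glue_lint), and it elaborates with this file. -/

@[closes "route-NavierStokesRegularity-RootDecompStaticSkirt"] theorem closes (hK : LitSliceConeRest) (hRS : NoStaticSupercriticalSkirt) (hLJ : NoJoltingSupercriticalSkirt) : NavierStokesRegularity :=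
  Summit.NavierStokesRegularity.NavierStokesRegularity.Theses.RootDecompLitSlice.closes hK.1 hK.2.1 hK.2.2.1 (by
    intro ν T hν hT u p hmax hLH hdec htend x₀
    by_contra hU
    push_neg at hU
    have key : ∀ n : ℕ, ∃ ρ : ℝ, ρ ∈ Set.Ioo 0 (1 / ((n : ℝ) + 1)) ∧
        (n : ℝ) < ρ⁻¹ * ∫ x in Metric.ball x₀ ρ, ‖u T x‖ ^ 2 := fun n => by
      obtain ⟨ρ, hρ, hlt⟩ := hU n (1 / ((n : ℝ) + 1)) (by positivity)
      exact ⟨ρ, hρ, hlt⟩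
    choose r hr hlt using key
    have hpos : ∀ k, 0 < r k := fun k => (hr k).1
    have hr0 : Filter.Tendsto r Filter.atTop (nhds 0) :=
      squeeze_zero (fun k => (hr k).1.le) (fun k => (hr k).2.le) tendsto_one_div_add_atTop_nhds_zero_nat
    have hS : Filter.Tendsto (fun k => (r k)⁻¹ * ∫ x in Metric.ball x₀ (r k), ‖u T x‖ ^ 2) Filter.atTop Filter.atTop :=
      Filter.tendsto_atTop_mono (fun k => (hlt k).le) tendsto_natCast_atTop_atTop
    have hns := hRS ν T hν hT u p hmax hLH hdec htend x₀ r ⟨hpos, hr0, hS⟩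
    push_neg at hns
    obtain ⟨ε, hε, hfreq⟩ := hns
    have hf : ∃ᶠ k in Filter.atTop, ∃ t ∈ Set.Ioo (T - r k ^ 2) T,
        ε * (∫ x in Metric.ball x₀ (r k), ‖u T x‖ ^ 2) < ∫ x in Metric.ball x₀ (r k), ‖u t x - u T x‖ ^ 2 :=
      Filter.frequently_atTop.2 fun k₀ => by
        obtain ⟨k, hk, t, ht, hlt⟩ := hfreq k₀
        exact ⟨k, hk, t, ht, hlt⟩
    obtain ⟨φ, hφ, hP⟩ := Filter.extraction_of_frequently_atTop hf
    exact hLJ ν T hν hT u p hmax hLH hdec htend x₀ (r ∘ φ)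
      ⟨fun k => hpos (φ k), hr0.comp hφ.tendsto_atTop, hS.comp hφ.tendsto_atTop⟩ ⟨ε, hε, fun k => hP k⟩)
    hK.2.2.2.1 hK.2.2.2.2.1 hK.2.2.2.2.2

end Summit.NavierStokesRegularity.NavierStokesRegularity.Theses.RootDecompStaticSkirt
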